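import Literature.NumberTheory.Rogawski1990.SmoothTransferSplitPlaceHSide   -- ★ `classOrbitalIntegral_comp_mulEquiv_eq_orbitalIntegral_of_isCanonical` (transport of a canonical class orbital integral along `j : H ≃* M`)
import Literature.NumberTheory.Automorphic.OrbitalMeasureCanonicalAtPoint   -- ★ `IsCanonical.classOrbitalIntegral_mk_eq_orbitalIntegral'`, ★ `apply_out_conjClassesMk_of_forall_conj`
import HarnessLib

/-!
# Haar-preserving automorphisms transport canonical orbital integrals: `Φ(⟦γ⟧, F ∘ e) = Φ(⟦e γ⟧, F)`

Rogawski [Rogawski1990, §4.3 (4.3.1) p. 43] normalises `Φ(γ, f) = ∫_{G_γ \ G} f(g⁻¹ γ g) dg∕dt` with COMPATIBLE measures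
(`dt` canonical on the centraliser: mass one on its compact core, ★ `OrbitalMeasureFamily.IsCanonical`).  With this
normalisation every automorphism `e` of the locally compact group `G` preserving the Haar measure `dg` transports the
orbital integrals: **`Φ(⟦γ⟧, F ∘ e) = Φ(⟦e γ⟧, F)`** (canonical torus measures go to canonical torus measures; ★
`classOrbitalIntegral_comp_mulEquiv_eq_orbitalIntegral_of_isCanonical` with `j = e`, `ν_M = e_* ν = ν`), hence
`Φ(⟦γ⟧, 𝟙_{e C}) = Φ(⟦e⁻¹ γ⟧, 𝟙_C)` and, at classes fixed by `e`, `Φ(⟦γ⟧, 𝟙_{e C}) = Φ(⟦γ⟧, 𝟙_C)`.  A HALF-INNER automorphism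
(`e ∘ e` inner) of a unimodular group preserves Haar measure (`e_* dg = c · dg`, `(e ∘ e)_* dg = dg`, so `c² = 1`):
the case of `Ad d`, `d = diag(1, ϖ)`, on `U(1,1)` exchanging the two vertex classes of the tree in Kottwitz's
computation of the orbital integrals of the Euler–Poincaré function [Kottwitz1988, §2] (consumer: ★-to-be
`UnitaryOrbitalIntegralSimilitudeTransport`).
-/

noncomputable section

open MeasureTheory Measure Topology Filter Set NumberField IsDedekindDomain
open scoped ENNReal NNReal Matrix MatrixGroups

namespace Literature.NumberTheory.Automorphic

open Literature.MeasureTheory.Group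

/-! ## §1 Haar-preserving automorphisms transport canonical class orbital integrals -/

section Generic

variable {G : Type*} [Group G] [TopologicalSpace G] [IsTopologicalGroup G] [LocallyCompactSpace G]
  [SecondCountableTopology G] [T2Space G] [MeasurableSpace G] [BorelSpace G]
  [∀ γ : G, MeasurableSpace (G ⧸ Subgroup.centralizer ({γ} : Set G))]
  [∀ γ : G, BorelSpace (G ⧸ Subgroup.centralizer ({γ} : Set G))]

omit [T2Space G] [∀ γ : G, MeasurableSpace (G ⧸ Subgroup.centralizer ({γ} : Set G))]
  [∀ γ : G, BorelSpace (G ⧸ Subgroup.centralizer ({γ} : Set G))] in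
/-- **A half-inner automorphism of a unimodular group preserves Haar measure.**  For `e : G ≃ₜ* G` with `e ∘ e = Ad u`
inner and `ν` a two-sided Haar measure: `e_* ν = ν` (`e_* ν = c • ν` by uniqueness, `(Ad u)_* ν = ν`, so `c² = 1`).
[cite: DeitmarEchterhoff2014, Thm. 1.5.3] [cite: Folland1995, Thm. 2.20] -/
theorem map_continuousMulEquiv_eq_self_of_apply_apply_eq_conj (ν : Measure G) [ν.IsHaarMeasure]
    [ν.IsMulRightInvariant] (e : G ≃ₜ* G) (u : G) (he : ∀ g, e (e g) = u * g * u⁻¹) : ν.map e = ν := by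
  haveI : (ν.map e).IsHaarMeasure := e.isHaarMeasure_map ν
  set c : ℝ≥0 := haarScalarFactor (ν.map e) ν with hc_def
  have hc : ν.map e = c • ν := isMulLeftInvariant_eq_smul _ _
  have hme : Measurable e := e.continuous.measurable
  -- `(e ∘ e)_* ν = (Ad u)_* ν = ν`
  have hee : (ν.map e).map e = ν := by
    rw [Measure.map_map hme hme]
    have hcomp : ((e : G → G) ∘ e) = (MulAut.conj u : G ≃* G) := funext fun g => by simp [he]
    rw [hcomp]
    exact map_mulAutConj_eq_self ν u
  -- hence `c² = 1`, `c = 1`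
  rw [hc, Measure.map_smul, hc, smul_smul] at hee
  obtain ⟨K, hK, hK1⟩ := exists_compact_mem_nhds (1 : G)
  have hK0 : ν K ≠ 0 := (measure_pos_of_mem_nhds ν hK1).ne'
  have hKt : ν K ≠ ⊤ := hK.measure_lt_top.ne
  have hcc : ((c * c : ℝ≥0) : ℝ≥0∞) * ν K = 1 * ν K := by
    rw [one_mul]
    have := congrArg (fun μ : Measure G => μ K) hee
    simpa only [Measure.coe_nnreal_smul_apply] using this
  have hcc1 : c * c = 1 := by exact_mod_cast (ENNReal.mul_left_inj hK0 hKt).1 hcc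
  have hc1 : c = 1 := by
    have h0 : (0 : ℝ) ≤ c := c.2
    have h1 : (c : ℝ) * c = 1 := by exact_mod_cast hcc1
    have : (c : ℝ) = 1 := by nlinarith
    exact_mod_cast this
  rw [hc, hc1, one_smul]

omit [IsTopologicalGroup G] [LocallyCompactSpace G] [SecondCountableTopology G] [T2Space G]
  [∀ γ : G, MeasurableSpace (G ⧸ Subgroup.centralizer ({γ} : Set G))]
  [∀ γ : G, BorelSpace (G ⧸ Subgroup.centralizer ({γ} : Set G))] in
/-- If `e_* ν = ν` then `(e⁻¹)_* ν = ν`. [cite: Folland1995, Thm. 2.20] -/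
theorem map_continuousMulEquiv_symm_eq_self (ν : Measure G) (e : G ≃ₜ* G) (he : ν.map e = ν) :
    ν.map e.symm = ν := by
  have hme : Measurable (e : G → G) := e.continuous.measurable
  have hms : Measurable (e.symm : G → G) := e.symm.continuous.measurable
  conv_lhs => rw [← he]
  rw [Measure.map_map hms hme]
  have : ((e.symm : G → G) ∘ e) = id := funext fun g => e.symm_apply_apply g
  rw [this, Measure.map_id]

omit [IsTopologicalGroup G] [LocallyCompactSpace G] [SecondCountableTopology G] [T2Space G]
  [∀ γ : G, MeasurableSpace (G ⧸ Subgroup.centralizer ({γ} : Set G))]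
  [∀ γ : G, BorelSpace (G ⧸ Subgroup.centralizer ({γ} : Set G))] in
/-- **Volumes of images**: if `e_* ν = ν` then `ν (e C) = ν C` for every set `C` (`e C = e⁻¹ ⁻¹' C`, `(e⁻¹)_* ν = ν`) — on
`U(1,1)`: `vol K′ = vol K` for the two vertex stabilisers. [cite: Folland1995, Thm. 2.20] [cite: Kottwitz1988, §2] -/
theorem measure_image_eq_of_map_continuousMulEquiv_eq_self (ν : Measure G) (e : G ≃ₜ* G) (he : ν.map e = ν)
    (C : Set G) : ν (e '' C) = ν C := by
  have himage : Set.image (e : G → G) = Set.preimage (e.symm : G → G) :=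
    Set.image_eq_preimage_of_inverse e.symm_apply_apply e.apply_symm_apply
  rw [himage, ← map_continuousMulEquiv_apply e.symm ν C, map_continuousMulEquiv_symm_eq_self ν e he]

/-- **Transport of canonical class orbital integrals along a Haar-preserving automorphism.**  For `m` canonical for
`(P, ν)` (`P` a class function), `e : G ≃ₜ* G` with `e_* ν = ν`, `γ` and `e γ` in `P`, and every `F : G → ℂ`:
**`Φ(⟦γ⟧, F ∘ e; m) = Φ(⟦e γ⟧, F; m)`** — both sides are the orbital integral of `F` at `e γ` against `ν ∕ t` with `t`
THE canonical torus measure on `G_{e γ}` (★ `classOrbitalIntegral_comp_mulEquiv_eq_orbitalIntegral_of_isCanonical` with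
`j = e`, `ν_M = e_* ν = ν`; ★ `IsCanonical.classOrbitalIntegral_mk_eq_orbitalIntegral'`): Rogawski's «the orbital integrals
are defined using compatible measures». [cite: Rogawski1990, §4.3 (4.3.1) p. 43] [cite: DeitmarEchterhoff2014, Thm. 1.5.3] -/
theorem OrbitalMeasureFamily.IsCanonical.classOrbitalIntegral_comp_continuousMulEquiv_eq
    {P : G → Prop} (hP : ∀ g x : G, P g → P (x * g * x⁻¹)) {ν : Measure G} [ν.IsHaarMeasure] [ν.IsMulRightInvariant]
    {m : OrbitalMeasureFamily G} (hm : m.IsCanonical P ν) (e : G ≃ₜ* G) (he : ν.map e = ν)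
    {γ : G} (hγ : P γ) (heγ : P (e γ)) (F : G → ℂ) :
    classOrbitalIntegral m (F ∘ e) (ConjClasses.mk γ) = classOrbitalIntegral m F (ConjClasses.mk (e γ)) := by
  obtain ⟨t, ht, hti, ht1, -⟩ := hm.atPoint_eq_quotientMeasure (e γ) (apply_out_conjClassesMk_of_forall_conj hP heγ)
  rw [hm.classOrbitalIntegral_mk_eq_orbitalIntegral' hP heγ t ht1 F]
  exact classOrbitalIntegral_comp_mulEquiv_eq_orbitalIntegral_of_isCanonical e.toMulEquiv e.continuous
    e.symm.continuous hm γ (apply_out_conjClassesMk_of_forall_conj hP hγ) ν he.symm t ht1 F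

omit [TopologicalSpace G] [IsTopologicalGroup G] [LocallyCompactSpace G] [SecondCountableTopology G] [T2Space G]
  [MeasurableSpace G] [BorelSpace G] [∀ γ : G, MeasurableSpace (G ⧸ Subgroup.centralizer ({γ} : Set G))]
  [∀ γ : G, BorelSpace (G ⧸ Subgroup.centralizer ({γ} : Set G))] in
/-- `𝟙_C ∘ e⁻¹ = 𝟙_{e C}`. [folklore] -/
private theorem indicator_comp_symm_eq {H : Type*} [Group H] [TopologicalSpace G] [TopologicalSpace H]
    (e : G ≃ₜ* H) (C : Set G) :
    ((C.indicator fun _ => (1 : ℂ)) ∘ e.symm) = (e '' C).indicator fun _ => (1 : ℂ) := by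
  have himage : Set.image (e : G → H) = Set.preimage (e.symm : H → G) :=
    Set.image_eq_preimage_of_inverse e.symm_apply_apply e.apply_symm_apply
  funext x
  rw [Function.comp_apply, himage]
  exact (Set.indicator_comp_right (e.symm : H → G) (g := fun _ : G => (1 : ℂ))).symm

/-- **`𝟙_{e C}` form**: `Φ(⟦γ⟧, 𝟙_{e C}; m) = Φ(⟦e⁻¹ γ⟧, 𝟙_C; m)` for every set `C ⊆ G` (`𝟙_{e C} = 𝟙_C ∘ e⁻¹`,
`(e⁻¹)_* ν = ν`). [cite: Rogawski1990, §4.3 (4.3.1) p. 43] [cite: Kottwitz1988, §2] -/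
theorem OrbitalMeasureFamily.IsCanonical.classOrbitalIntegral_indicator_image_eq
    {P : G → Prop} (hP : ∀ g x : G, P g → P (x * g * x⁻¹)) {ν : Measure G} [ν.IsHaarMeasure] [ν.IsMulRightInvariant]
    {m : OrbitalMeasureFamily G} (hm : m.IsCanonical P ν) (e : G ≃ₜ* G) (he : ν.map e = ν) (C : Set G)
    {γ : G} (hγ : P γ) (heγ : P (e.symm γ)) :
    classOrbitalIntegral m ((e '' C).indicator fun _ => (1 : ℂ)) (ConjClasses.mk γ) =
      classOrbitalIntegral m (C.indicator fun _ => (1 : ℂ)) (ConjClasses.mk (e.symm γ)) := by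
  rw [← indicator_comp_symm_eq e C]
  exact hm.classOrbitalIntegral_comp_continuousMulEquiv_eq hP e.symm (map_continuousMulEquiv_symm_eq_self ν e he)
    hγ heγ _

/-- **Fixed classes**: if `e γ = γ` (e.g. `e = Ad T` and `T` commutes with `γ`) then `Φ(⟦γ⟧, F ∘ e; m) = Φ(⟦γ⟧, F; m)`
for every `F` — in particular `Φ(⟦γ⟧, 𝟙_{e C}) = Φ(⟦γ⟧, 𝟙_C)`. [cite: Rogawski1990, §4.3 (4.3.1) p. 43] [cite: Kottwitz1988, §2] -/
theorem OrbitalMeasureFamily.IsCanonical.classOrbitalIntegral_comp_continuousMulEquiv_eq_of_apply_eq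
    {P : G → Prop} (hP : ∀ g x : G, P g → P (x * g * x⁻¹)) {ν : Measure G} [ν.IsHaarMeasure] [ν.IsMulRightInvariant]
    {m : OrbitalMeasureFamily G} (hm : m.IsCanonical P ν) (e : G ≃ₜ* G) (he : ν.map e = ν)
    {γ : G} (hγ : P γ) (hfix : e γ = γ) (F : G → ℂ) :
    classOrbitalIntegral m (F ∘ e) (ConjClasses.mk γ) = classOrbitalIntegral m F (ConjClasses.mk γ) := by
  have h := hm.classOrbitalIntegral_comp_continuousMulEquiv_eq hP e he hγ (hfix.symm ▸ hγ) F
  rwa [hfix] at h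

/-- Fixed classes, `𝟙_{e C}` form: `e γ = γ` ⇒ `Φ(⟦γ⟧, 𝟙_{e C}) = Φ(⟦γ⟧, 𝟙_C)`. [cite: Kottwitz1988, §2] -/
theorem OrbitalMeasureFamily.IsCanonical.classOrbitalIntegral_indicator_image_eq_of_apply_eq
    {P : G → Prop} (hP : ∀ g x : G, P g → P (x * g * x⁻¹)) {ν : Measure G} [ν.IsHaarMeasure] [ν.IsMulRightInvariant]
    {m : OrbitalMeasureFamily G} (hm : m.IsCanonical P ν) (e : G ≃ₜ* G) (he : ν.map e = ν) (C : Set G)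
    {γ : G} (hγ : P γ) (hfix : e γ = γ) :
    classOrbitalIntegral m ((e '' C).indicator fun _ => (1 : ℂ)) (ConjClasses.mk γ) =
      classOrbitalIntegral m (C.indicator fun _ => (1 : ℂ)) (ConjClasses.mk γ) := by
  have hfix' : e.symm γ = γ := by rw [← hfix, e.symm_apply_apply, hfix]
  have h := hm.classOrbitalIntegral_indicator_image_eq hP e he C hγ (hfix'.symm ▸ hγ)
  rwa [hfix'] at h

end Generic

end Literature.NumberTheory.Automorphic

end
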